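import Summits.QuantumFields.BalabanUV.Beta.D1BFx.LogDetSecondVariation

/-!
# `BalabanUV.Beta.D1BFx.SliceTransferJetsAlgebra` — road «BF-x» for binder row D1, leaf K-R1 AT MODEL LEVEL, JET FORM (part 1: algebra)

Pure matrix algebra for the JET form of the slice-transfer identity (`SliceTransferModel.secondVar_sliceTransfer`):
* §1 the one-loop functional `secondVar` of a PRODUCT of 2-jets and of the INVERSE 2-jet (`secondVar_mul_right`, `secondVar_inv_jets`,
  `secondVar_one`);
* §2 the REPARAMETRISATION `W ↦ W·(τW)⁻¹` at the level of 2-jets (`sJ₀/sJ₁/sJ₂`, `wT₀/wT₁/wT₂`; `τ·W̃ ≡ (1, 0, 0)`), the transport of the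
  algebraic Ward relations `K₀W₀ = 0`, `K₁W₀ + K₀W₁ = 0`, `K₂W₀ + 2K₁W₁ + K₀W₂ = 0` (and `Q`'s) to the reparametrised jets, and the
  product rule `(P·W)·S`-jets `= P·W̃`-jets;
* §3 the 2-jets of the EXACTLY INVARIANT dressed data `Πᵀ K Π`, `Q Π` with `Π = 1 − W̃τ` (`Π₀ = 1 − W̃₀τ`, `Π₁ = −W̃₁τ`, `Π₂ = −W̃₂τ`):
  they are `(K₀, K₁, K₂)` and `(Q₀, Q₁, Q₂)` again, BY the Ward relations (six rewrite rules).
Part 2 (`SliceTransferJets`) feeds polynomial curves with these jets to the landed curve theorem.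

HONEST FRAMING (cell contract, verbatim): «discharging `BetaPertH` makes Bałaban's UV stability UNCONDITIONAL — a real constructive-QFT
result; it is NOT the continuum limit and NOT the Clay problem.»  HONEST DEPENDENCY (verbatim): «continuum YM on T⁴ ⇐ BetaPertH ∧ nine
spine estimates (0/9 proved); BetaPertH ⇐ (D1) ∧ (D4) ∧ CAP+tail; G-an2-4 gates asym, D1 and NE2/3/4.»  [folklore] finite-dimensional algebra;
no `Prop` is minted, nothing is cited, no wall binder is instantiated; 0 sorry.  NOT summit progress.
ABSOLUTE RULE (cell, verbatim): «No internally-minted statement may enter as a cited fact. Every hypothesis is either kernel-proved in this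
package or a verbatim quotation of a PUBLISHED theorem with page reference. The manuscript(s) under audit are NOT citable for their own
disputed steps — they are the thing under adjudication; programme-internal (2001/route/tribunal) claims are never citable.»
Provenance: road «BF-x» owner gen 4 (prover-b2b-balaban-beta-d1-p2-g4-0), K-R1-SPEC v2 §4 X₃(i), 2026-08-20.
-/

noncomputable section

namespace Summit.QuantumFields.BalabanUV.Beta.D1BFx.SliceTransferJetsAlgebra

open Matrix
open Summit.QuantumFields.BalabanUV.Beta.D1BFx.LogDetSecondVariation (secondVar)

/-! ## §1 `secondVar` of products and inverses of 2-jets -/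

section Products

variable {ι : Type*} [Fintype ι] [DecidableEq ι]

/-- [folklore] The trivial curve: `secondVar 1 0 0 = 0`. -/
theorem secondVar_one : secondVar (1 : Matrix ι ι ℝ) 0 0 = 0 := by
  simp [secondVar]

/-- [folklore] **`secondVar` OF A PRODUCT OF 2-JETS** (`log det (F·S) = log det F + log det S`, differentiated twice):
`secondVar (F₀S₀) (F₁S₀ + F₀S₁) (F₂S₀ + 2·F₁S₁ + F₀S₂) = secondVar F₀ F₁ F₂ + secondVar S₀ S₁ S₂` for invertible `F₀`, `S₀`. -/
theorem secondVar_mul_right (F₀ F₁ F₂ S₀ S₁ S₂ : Matrix ι ι ℝ) (hF : F₀.det ≠ 0) (hS : S₀.det ≠ 0) :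
    secondVar (F₀ * S₀) (F₁ * S₀ + F₀ * S₁) (F₂ * S₀ + (2 : ℝ) • (F₁ * S₁) + F₀ * S₂)
      = secondVar F₀ F₁ F₂ + secondVar S₀ S₁ S₂ := by
  have hFu : IsUnit F₀.det := isUnit_iff_ne_zero.2 hF
  have hSu : IsUnit S₀.det := isUnit_iff_ne_zero.2 hS
  have hSS : S₀ * S₀⁻¹ = 1 := Matrix.mul_nonsing_inv _ hSu
  have hFF : F₀⁻¹ * F₀ = 1 := Matrix.nonsing_inv_mul _ hFu
  have hinv : (F₀ * S₀)⁻¹ = S₀⁻¹ * F₀⁻¹ := Matrix.mul_inv_rev _ _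
  -- conjugation by `S₀` inside the trace
  have conj : ∀ X : Matrix ι ι ℝ, (S₀⁻¹ * X * S₀).trace = X.trace := by
    intro X
    rw [Matrix.trace_mul_cycle, hSS, Matrix.one_mul]
  -- tadpole
  have t1 : ((F₀ * S₀)⁻¹ * (F₂ * S₀ + (2 : ℝ) • (F₁ * S₁) + F₀ * S₂)).trace
      = (F₀⁻¹ * F₂).trace + 2 * (S₀⁻¹ * F₀⁻¹ * F₁ * S₁).trace + (S₀⁻¹ * S₂).trace := by
    rw [hinv, Matrix.mul_add, Matrix.mul_add, Matrix.trace_add, Matrix.trace_add]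
    have e1 : (S₀⁻¹ * F₀⁻¹ * (F₂ * S₀)).trace = (F₀⁻¹ * F₂).trace := by
      rw [show S₀⁻¹ * F₀⁻¹ * (F₂ * S₀) = S₀⁻¹ * (F₀⁻¹ * F₂) * S₀ by simp only [Matrix.mul_assoc], conj]
    have e2 : (S₀⁻¹ * F₀⁻¹ * ((2 : ℝ) • (F₁ * S₁))).trace = 2 * (S₀⁻¹ * F₀⁻¹ * F₁ * S₁).trace := by
      rw [Matrix.mul_smul, Matrix.trace_smul, smul_eq_mul]
      simp only [Matrix.mul_assoc]
    have e3 : (S₀⁻¹ * F₀⁻¹ * (F₀ * S₂)).trace = (S₀⁻¹ * S₂).trace := by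
      rw [show S₀⁻¹ * F₀⁻¹ * (F₀ * S₂) = S₀⁻¹ * (F₀⁻¹ * F₀) * S₂ by simp only [Matrix.mul_assoc], hFF, Matrix.mul_one]
    rw [e1, e2, e3]
  -- bubble
  set X : Matrix ι ι ℝ := S₀⁻¹ * (F₀⁻¹ * F₁) * S₀ with hX
  set Y : Matrix ι ι ℝ := S₀⁻¹ * S₁ with hY
  have hXY : (F₀ * S₀)⁻¹ * (F₁ * S₀ + F₀ * S₁) = X + Y := by
    rw [hinv, Matrix.mul_add, hX, hY]
    congr 1
    · simp only [Matrix.mul_assoc]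
    · rw [show S₀⁻¹ * F₀⁻¹ * (F₀ * S₁) = S₀⁻¹ * (F₀⁻¹ * F₀) * S₁ by simp only [Matrix.mul_assoc], hFF, Matrix.mul_one]
  have bXX : (X * X).trace = (F₀⁻¹ * F₁ * (F₀⁻¹ * F₁)).trace := by
    rw [hX, show S₀⁻¹ * (F₀⁻¹ * F₁) * S₀ * (S₀⁻¹ * (F₀⁻¹ * F₁) * S₀)
      = S₀⁻¹ * (F₀⁻¹ * F₁ * (S₀ * S₀⁻¹) * (F₀⁻¹ * F₁)) * S₀ by simp only [Matrix.mul_assoc], hSS, Matrix.mul_one, conj]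
  have bXY : (X * Y).trace = (S₀⁻¹ * F₀⁻¹ * F₁ * S₁).trace := by
    rw [hX, hY, show S₀⁻¹ * (F₀⁻¹ * F₁) * S₀ * (S₀⁻¹ * S₁) = S₀⁻¹ * F₀⁻¹ * F₁ * (S₀ * S₀⁻¹) * S₁ by
      simp only [Matrix.mul_assoc], hSS, Matrix.mul_one]
  have bYX : (Y * X).trace = (S₀⁻¹ * F₀⁻¹ * F₁ * S₁).trace := by
    rw [Matrix.trace_mul_comm, bXY]
  have b1 : ((F₀ * S₀)⁻¹ * (F₁ * S₀ + F₀ * S₁) * ((F₀ * S₀)⁻¹ * (F₁ * S₀ + F₀ * S₁))).trace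
      = (F₀⁻¹ * F₁ * (F₀⁻¹ * F₁)).trace + 2 * (S₀⁻¹ * F₀⁻¹ * F₁ * S₁).trace + (S₀⁻¹ * S₁ * (S₀⁻¹ * S₁)).trace := by
    rw [hXY, Matrix.add_mul, Matrix.mul_add, Matrix.mul_add, Matrix.trace_add, Matrix.trace_add, Matrix.trace_add, bXX, bXY, bYX,
      ← hY]
    ring
  unfold secondVar
  rw [t1, b1]
  ring

/-- [folklore] **`secondVar` OF THE INVERSE 2-JET**: with `S₀ = G₀⁻¹`, `S₁ = −S₀G₁S₀`, `S₂ = −S₀G₂S₀ + 2·S₀G₁S₀G₁S₀` (the jets of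
`u ↦ G(u)⁻¹`), `secondVar S₀ S₁ S₂ = −secondVar G₀ G₁ G₂`. -/
theorem secondVar_inv_jets (G₀ G₁ G₂ : Matrix ι ι ℝ) (hG : G₀.det ≠ 0) :
    secondVar G₀⁻¹ (-(G₀⁻¹ * G₁ * G₀⁻¹)) (-(G₀⁻¹ * G₂ * G₀⁻¹) + (2 : ℝ) • (G₀⁻¹ * G₁ * G₀⁻¹ * G₁ * G₀⁻¹))
      = -secondVar G₀ G₁ G₂ := by
  have hGu : IsUnit G₀.det := isUnit_iff_ne_zero.2 hG
  have hii : G₀⁻¹⁻¹ = G₀ := Matrix.nonsing_inv_nonsing_inv _ hGu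
  have hGS : G₀ * G₀⁻¹ = 1 := Matrix.mul_nonsing_inv _ hGu
  unfold secondVar
  rw [hii]
  have e1 : (G₀ * (-(G₀⁻¹ * G₂ * G₀⁻¹) + (2 : ℝ) • (G₀⁻¹ * G₁ * G₀⁻¹ * G₁ * G₀⁻¹))).trace
      = -(G₀⁻¹ * G₂).trace + 2 * (G₀⁻¹ * G₁ * (G₀⁻¹ * G₁)).trace := by
    rw [Matrix.mul_add, Matrix.mul_neg, Matrix.mul_smul, Matrix.trace_add, Matrix.trace_neg, Matrix.trace_smul, smul_eq_mul]
    have a : G₀ * (G₀⁻¹ * G₂ * G₀⁻¹) = G₂ * G₀⁻¹ := by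
      rw [show G₀ * (G₀⁻¹ * G₂ * G₀⁻¹) = G₀ * G₀⁻¹ * G₂ * G₀⁻¹ by simp only [Matrix.mul_assoc], hGS, Matrix.one_mul]
    have b : G₀ * (G₀⁻¹ * G₁ * G₀⁻¹ * G₁ * G₀⁻¹) = G₁ * G₀⁻¹ * G₁ * G₀⁻¹ := by
      rw [show G₀ * (G₀⁻¹ * G₁ * G₀⁻¹ * G₁ * G₀⁻¹) = G₀ * G₀⁻¹ * G₁ * G₀⁻¹ * G₁ * G₀⁻¹ by simp only [Matrix.mul_assoc], hGS,
        Matrix.one_mul]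
    rw [a, b, Matrix.trace_mul_comm G₂, show G₁ * G₀⁻¹ * G₁ * G₀⁻¹ = G₁ * (G₀⁻¹ * G₁ * G₀⁻¹) by simp only [Matrix.mul_assoc],
      Matrix.trace_mul_comm G₁, show G₀⁻¹ * G₁ * G₀⁻¹ * G₁ = G₀⁻¹ * G₁ * (G₀⁻¹ * G₁) by simp only [Matrix.mul_assoc]]
  have e2 : (G₀ * -(G₀⁻¹ * G₁ * G₀⁻¹) * (G₀ * -(G₀⁻¹ * G₁ * G₀⁻¹))).trace = (G₀⁻¹ * G₁ * (G₀⁻¹ * G₁)).trace := by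
    have a : G₀ * -(G₀⁻¹ * G₁ * G₀⁻¹) = -(G₁ * G₀⁻¹) := by
      rw [Matrix.mul_neg, show G₀ * (G₀⁻¹ * G₁ * G₀⁻¹) = G₀ * G₀⁻¹ * G₁ * G₀⁻¹ by simp only [Matrix.mul_assoc], hGS, Matrix.one_mul]
    rw [a, neg_mul_neg, show G₁ * G₀⁻¹ * (G₁ * G₀⁻¹) = G₁ * (G₀⁻¹ * G₁ * G₀⁻¹) by simp only [Matrix.mul_assoc],
      Matrix.trace_mul_comm G₁, show G₀⁻¹ * G₁ * G₀⁻¹ * G₁ = G₀⁻¹ * G₁ * (G₀⁻¹ * G₁) by simp only [Matrix.mul_assoc]]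
  rw [e1, e2]
  ring

end Products

/-! ## §2 The reparametrisation `W ↦ W·(τW)⁻¹` on 2-jets -/

section Reparam

variable {ν ρ : Type*} [Fintype ν] [Fintype ρ] [DecidableEq ρ]

/-- [our object] Zeroth jet of `S(u) := (τ·W(u))⁻¹`. -/
def sJ₀ (τ : Matrix ρ ν ℝ) (W₀ : Matrix ν ρ ℝ) : Matrix ρ ρ ℝ := (τ * W₀)⁻¹

/-- [our object] First jet of `S(u) := (τ·W(u))⁻¹`: `−S₀(τW₁)S₀`. -/
def sJ₁ (τ : Matrix ρ ν ℝ) (W₀ W₁ : Matrix ν ρ ℝ) : Matrix ρ ρ ℝ := -(sJ₀ τ W₀ * (τ * W₁) * sJ₀ τ W₀)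

/-- [our object] Second jet of `S(u) := (τ·W(u))⁻¹`: `−S₀(τW₂)S₀ + 2·S₀(τW₁)S₀(τW₁)S₀`. -/
def sJ₂ (τ : Matrix ρ ν ℝ) (W₀ W₁ W₂ : Matrix ν ρ ℝ) : Matrix ρ ρ ℝ :=
  -(sJ₀ τ W₀ * (τ * W₂) * sJ₀ τ W₀) + (2 : ℝ) • (sJ₀ τ W₀ * (τ * W₁) * sJ₀ τ W₀ * (τ * W₁) * sJ₀ τ W₀)

/-- [our object] Reparametrised zeroth jet `W̃₀ := W₀S₀`. -/
def wT₀ (τ : Matrix ρ ν ℝ) (W₀ : Matrix ν ρ ℝ) : Matrix ν ρ ℝ := W₀ * sJ₀ τ W₀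

/-- [our object] Reparametrised first jet `W̃₁ := W₁S₀ + W₀S₁`. -/
def wT₁ (τ : Matrix ρ ν ℝ) (W₀ W₁ : Matrix ν ρ ℝ) : Matrix ν ρ ℝ := W₁ * sJ₀ τ W₀ + W₀ * sJ₁ τ W₀ W₁

/-- [our object] Reparametrised second jet `W̃₂ := W₂S₀ + 2·W₁S₁ + W₀S₂`. -/
def wT₂ (τ : Matrix ρ ν ℝ) (W₀ W₁ W₂ : Matrix ν ρ ℝ) : Matrix ν ρ ℝ :=
  W₂ * sJ₀ τ W₀ + (2 : ℝ) • (W₁ * sJ₁ τ W₀ W₁) + W₀ * sJ₂ τ W₀ W₁ W₂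

variable (τ : Matrix ρ ν ℝ) (W₀ W₁ W₂ : Matrix ν ρ ℝ)

/-- [folklore] `τ·W̃₀ = 1`. -/
theorem tau_wT₀ (hτ : (τ * W₀).det ≠ 0) : τ * wT₀ τ W₀ = 1 := by
  unfold wT₀ sJ₀
  rw [← Matrix.mul_assoc, Matrix.mul_nonsing_inv _ (isUnit_iff_ne_zero.2 hτ)]

/-- [folklore] `τ·W̃₁ = 0`. -/
theorem tau_wT₁ (hτ : (τ * W₀).det ≠ 0) : τ * wT₁ τ W₀ W₁ = 0 := by
  have h0 : τ * W₀ * (τ * W₀)⁻¹ = 1 := Matrix.mul_nonsing_inv _ (isUnit_iff_ne_zero.2 hτ)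
  simp only [wT₁, sJ₁, sJ₀, Matrix.mul_add, Matrix.mul_neg, ← Matrix.mul_assoc, h0, Matrix.one_mul]
  exact add_neg_cancel _

/-- [folklore] `τ·W̃₂ = 0`. -/
theorem tau_wT₂ (hτ : (τ * W₀).det ≠ 0) : τ * wT₂ τ W₀ W₁ W₂ = 0 := by
  have h0 : τ * W₀ * (τ * W₀)⁻¹ = 1 := Matrix.mul_nonsing_inv _ (isUnit_iff_ne_zero.2 hτ)
  simp only [wT₂, sJ₂, sJ₁, sJ₀, Matrix.mul_add, Matrix.mul_neg, Matrix.mul_smul, ← Matrix.mul_assoc, h0,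
    Matrix.one_mul, smul_neg]
  abel

variable {τ W₀ W₁ W₂}

/-- [folklore] TRANSPORT OF THE WARD RELATIONS (right action): if `K₀W₀ = 0`, `K₁W₀ + K₀W₁ = 0`, `K₂W₀ + 2K₁W₁ + K₀W₂ = 0` then the same
hold for the reparametrised jets `W̃`.  Stated for an arbitrary left factor type (forms `K`, constraints `Q`). -/
theorem rel₀_wT {κ : Type*} {K₀ : Matrix κ ν ℝ} (a0 : K₀ * W₀ = 0) : K₀ * wT₀ τ W₀ = 0 := by
  unfold wT₀; rw [← Matrix.mul_assoc, a0, Matrix.zero_mul]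

/-- [folklore] Transport of the first-order Ward relation to the reparametrised jets. -/
theorem rel₁_wT {κ : Type*} {K₀ K₁ : Matrix κ ν ℝ} (a0 : K₀ * W₀ = 0) (a1 : K₁ * W₀ + K₀ * W₁ = 0) :
    K₁ * wT₀ τ W₀ + K₀ * wT₁ τ W₀ W₁ = 0 := by
  unfold wT₁ wT₀
  rw [Matrix.mul_add, ← Matrix.mul_assoc, ← Matrix.mul_assoc, ← Matrix.mul_assoc K₀ W₀, a0, Matrix.zero_mul, add_zero,
    ← Matrix.add_mul, a1, Matrix.zero_mul]

/-- [folklore] Transport of the second-order Ward relation to the reparametrised jets. -/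
theorem rel₂_wT {κ : Type*} {K₀ K₁ K₂ : Matrix κ ν ℝ} (a0 : K₀ * W₀ = 0) (a1 : K₁ * W₀ + K₀ * W₁ = 0)
    (a2 : K₂ * W₀ + (2 : ℝ) • (K₁ * W₁) + K₀ * W₂ = 0) :
    K₂ * wT₀ τ W₀ + (2 : ℝ) • (K₁ * wT₁ τ W₀ W₁) + K₀ * wT₂ τ W₀ W₁ W₂ = 0 := by
  unfold wT₂ wT₁ wT₀
  set S0 := sJ₀ τ W₀
  set S1 := sJ₁ τ W₀ W₁
  set S2 := sJ₂ τ W₀ W₁ W₂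
  have e : K₂ * (W₀ * S0) + (2 : ℝ) • (K₁ * (W₁ * S0 + W₀ * S1)) + K₀ * (W₂ * S0 + (2 : ℝ) • (W₁ * S1) + W₀ * S2)
      = (K₂ * W₀ + (2 : ℝ) • (K₁ * W₁) + K₀ * W₂) * S0 + (2 : ℝ) • ((K₁ * W₀ + K₀ * W₁) * S1) + K₀ * W₀ * S2 := by
    simp only [Matrix.mul_add, Matrix.add_mul, Matrix.mul_smul, Matrix.smul_mul, smul_add, Matrix.mul_assoc]
    abel
  rw [e, a2, a1, a0, Matrix.zero_mul, Matrix.zero_mul, Matrix.zero_mul, smul_zero, add_zero, add_zero]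

/-- [folklore] PRODUCT RULE `(P·W)·S = P·W̃` on 2-jets (zeroth). -/
theorem pw_wT₀ {κ : Type*} (P₀ : Matrix κ ν ℝ) : P₀ * W₀ * sJ₀ τ W₀ = P₀ * wT₀ τ W₀ := by
  unfold wT₀; rw [Matrix.mul_assoc]

/-- [folklore] PRODUCT RULE on 2-jets (first). -/
theorem pw_wT₁ {κ : Type*} (P₀ P₁ : Matrix κ ν ℝ) :
    (P₁ * W₀ + P₀ * W₁) * sJ₀ τ W₀ + P₀ * W₀ * sJ₁ τ W₀ W₁ = P₁ * wT₀ τ W₀ + P₀ * wT₁ τ W₀ W₁ := by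
  unfold wT₀ wT₁
  simp only [Matrix.add_mul, Matrix.mul_add, Matrix.mul_assoc]
  abel

/-- [folklore] PRODUCT RULE on 2-jets (second). -/
theorem pw_wT₂ {κ : Type*} (P₀ P₁ P₂ : Matrix κ ν ℝ) :
    (P₂ * W₀ + (2 : ℝ) • (P₁ * W₁) + P₀ * W₂) * sJ₀ τ W₀ + (2 : ℝ) • ((P₁ * W₀ + P₀ * W₁) * sJ₁ τ W₀ W₁) + P₀ * W₀ * sJ₂ τ W₀ W₁ W₂
      = P₂ * wT₀ τ W₀ + (2 : ℝ) • (P₁ * wT₁ τ W₀ W₁) + P₀ * wT₂ τ W₀ W₁ W₂ := by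
  unfold wT₀ wT₁ wT₂
  simp only [Matrix.add_mul, Matrix.mul_add, Matrix.smul_mul, Matrix.mul_smul, smul_add, Matrix.mul_assoc]
  abel

end Reparam

/-! ## §3 The 2-jets of the exactly invariant dressed data `Πᵀ K Π`, `Q Π` -/

section Dressed

variable {ν μ ρ : Type*} [Fintype ν] [Fintype ρ] [DecidableEq ν]

omit [DecidableEq ν] in
/-- [folklore] From a product relation `X * A = Y`, its left-multiplied form `Z * X * A = Z * Y`. -/
theorem mul_rel {κ κ' : Type*} [Fintype κ] {X : Matrix κ ν ℝ} {A : Matrix ν ν ℝ} {Y : Matrix κ ν ℝ} (h : X * A = Y)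
    (Z : Matrix κ' κ ℝ) : Z * X * A = Z * Y := by
  rw [Matrix.mul_assoc, h]

omit [DecidableEq ν] in
/-- [folklore] From `A * X = Y`, its right-multiplied form `A * (X * Z) = Y * Z`. -/
theorem rel_mul {κ κ' : Type*} [Fintype κ] {X : Matrix ν κ ℝ} {A : Matrix ν ν ℝ} {Y : Matrix ν κ ℝ} (h : A * X = Y)
    (Z : Matrix κ κ' ℝ) : A * (X * Z) = Y * Z := by
  rw [← Matrix.mul_assoc, h]

variable (K₀ K₁ K₂ A B C : Matrix ν ν ℝ)

/-- [folklore] **ZEROTH DRESSED JET**: `(1 − A)ᵀ K₀ (1 − A) = K₀` if `K₀A = 0`, `AᵀK₀ = 0`. -/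
theorem dressed_jet₀ (r0 : K₀ * A = 0) (l0 : Aᵀ * K₀ = 0) : (1 - A)ᵀ * K₀ * (1 - A) = K₀ := by
  rw [Matrix.transpose_sub, Matrix.transpose_one, Matrix.sub_mul, Matrix.one_mul, l0, sub_zero, Matrix.mul_sub, Matrix.mul_one, r0,
    sub_zero]

/-- [folklore] **FIRST DRESSED JET**: `Π₁ᵀK₀Π₀ + Π₀ᵀK₁Π₀ + Π₀ᵀK₀Π₁ = K₁` (`Π₀ = 1 − A`, `Π₁ = −B`) under the zeroth and first Ward rules
`K₀A = 0`, `AᵀK₀ = 0`, `K₁A = −K₀B`, `AᵀK₁ = −BᵀK₀`. -/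
theorem dressed_jet₁ (r0 : K₀ * A = 0) (l0 : Aᵀ * K₀ = 0) (r1 : K₁ * A = -(K₀ * B)) (l1 : Aᵀ * K₁ = -(Bᵀ * K₀)) :
    (-B)ᵀ * K₀ * (1 - A) + (1 - A)ᵀ * K₁ * (1 - A) + (1 - A)ᵀ * K₀ * (-B) = K₁ := by
  have e1 : (-B)ᵀ * K₀ * (1 - A) = -(Bᵀ * K₀) := by
    rw [Matrix.transpose_neg, Matrix.neg_mul, Matrix.neg_mul, Matrix.mul_sub, Matrix.mul_one, mul_rel r0, Matrix.mul_zero, sub_zero]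
  have e3 : (1 - A)ᵀ * K₀ * (-B) = -(K₀ * B) := by
    rw [Matrix.transpose_sub, Matrix.transpose_one, Matrix.sub_mul, Matrix.one_mul, l0, sub_zero, Matrix.mul_neg]
  have e2 : (1 - A)ᵀ * K₁ * (1 - A) = K₁ + K₀ * B + Bᵀ * K₀ := by
    rw [Matrix.transpose_sub, Matrix.transpose_one, Matrix.sub_mul, Matrix.one_mul, l1, Matrix.sub_mul, Matrix.mul_sub, Matrix.mul_one,
      r1, Matrix.neg_mul, Matrix.mul_sub, Matrix.mul_one, mul_rel r0, Matrix.mul_zero, sub_zero]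
    abel
  rw [e1, e2, e3]
  abel

/-- [folklore] **SECOND DRESSED JET**: `Π₂ᵀK₀Π₀ + Π₀ᵀK₂Π₀ + Π₀ᵀK₀Π₂ + 2·(Π₁ᵀK₁Π₀ + Π₁ᵀK₀Π₁ + Π₀ᵀK₁Π₁) = K₂` (`Π₂ = −C`) under the six
Ward rules (`K₂A = −2K₁B − K₀C`, `AᵀK₂ = −2BᵀK₁ − CᵀK₀` the second-order ones). -/
theorem dressed_jet₂ (r0 : K₀ * A = 0) (l0 : Aᵀ * K₀ = 0) (r1 : K₁ * A = -(K₀ * B)) (l1 : Aᵀ * K₁ = -(Bᵀ * K₀))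
    (r2 : K₂ * A = -((2 : ℝ) • (K₁ * B)) - K₀ * C) (l2 : Aᵀ * K₂ = -((2 : ℝ) • (Bᵀ * K₁)) - Cᵀ * K₀) :
    (-C)ᵀ * K₀ * (1 - A) + (1 - A)ᵀ * K₂ * (1 - A) + (1 - A)ᵀ * K₀ * (-C)
      + (2 : ℝ) • ((-B)ᵀ * K₁ * (1 - A) + (-B)ᵀ * K₀ * (-B) + (1 - A)ᵀ * K₁ * (-B)) = K₂ := by
  have t1 : (-C)ᵀ * K₀ * (1 - A) = -(Cᵀ * K₀) := by
    rw [Matrix.transpose_neg, Matrix.neg_mul, Matrix.neg_mul, Matrix.mul_sub, Matrix.mul_one, mul_rel r0, Matrix.mul_zero, sub_zero]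
  have t3 : (1 - A)ᵀ * K₀ * (-C) = -(K₀ * C) := by
    rw [Matrix.transpose_sub, Matrix.transpose_one, Matrix.sub_mul, Matrix.one_mul, l0, sub_zero, Matrix.mul_neg]
  have t5 : (-B)ᵀ * K₀ * (-B) = Bᵀ * K₀ * B := by
    rw [Matrix.transpose_neg, Matrix.neg_mul, Matrix.neg_mul, Matrix.mul_neg, neg_neg]
  have t2 : (1 - A)ᵀ * K₂ * (1 - A) = K₂ + (2 : ℝ) • (K₁ * B) + K₀ * C + (2 : ℝ) • (Bᵀ * K₁) + Cᵀ * K₀ + (2 : ℝ) • (Bᵀ * K₀ * B) := by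
    have hAKA : Aᵀ * K₂ * A = (2 : ℝ) • (Bᵀ * K₀ * B) := by
      rw [Matrix.mul_assoc, r2, Matrix.mul_sub, Matrix.mul_neg, Matrix.mul_smul, ← Matrix.mul_assoc, l1, ← Matrix.mul_assoc, l0,
        Matrix.zero_mul, sub_zero, Matrix.neg_mul, smul_neg, neg_neg]
    rw [Matrix.transpose_sub, Matrix.transpose_one]
    have e : ((1 : Matrix ν ν ℝ) - Aᵀ) * K₂ * (1 - A) = K₂ - K₂ * A - (Aᵀ * K₂ - Aᵀ * K₂ * A) := by
      simp only [Matrix.sub_mul, Matrix.mul_sub, Matrix.one_mul, Matrix.mul_one]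
      abel
    rw [e, hAKA, r2, l2]
    abel
  have t4 : (-B)ᵀ * K₁ * (1 - A) = -(Bᵀ * K₁) - Bᵀ * K₀ * B := by
    rw [Matrix.transpose_neg, Matrix.neg_mul, Matrix.neg_mul, Matrix.mul_sub, Matrix.mul_one, mul_rel r1, Matrix.mul_neg, ← Matrix.mul_assoc]
    abel
  have t6 : (1 - A)ᵀ * K₁ * (-B) = -(K₁ * B) - Bᵀ * K₀ * B := by
    rw [Matrix.transpose_sub, Matrix.transpose_one, Matrix.sub_mul, Matrix.one_mul, l1, Matrix.mul_neg, Matrix.sub_mul, Matrix.neg_mul]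
    abel
  rw [t1, t2, t3, t4, t5, t6]
  simp only [smul_add, smul_sub, smul_neg]
  abel

variable {K₀ K₁ K₂ A B C}
variable (Q₀ Q₁ Q₂ : Matrix μ ν ℝ)

/-- [folklore] Zeroth constraint jet: `Q₀(1 − A) = Q₀`. -/
theorem constraint_jet₀ (q0 : Q₀ * A = 0) : Q₀ * (1 - A) = Q₀ := by
  rw [Matrix.mul_sub, Matrix.mul_one, q0, sub_zero]

/-- [folklore] First constraint jet: `Q₁(1 − A) + Q₀(−B) = Q₁`. -/
theorem constraint_jet₁ (q1 : Q₁ * A = -(Q₀ * B)) : Q₁ * (1 - A) + Q₀ * (-B) = Q₁ := by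
  rw [Matrix.mul_sub, Matrix.mul_one, q1, Matrix.mul_neg]; abel

/-- [folklore] Second constraint jet: `Q₂(1 − A) + 2·Q₁(−B) + Q₀(−C) = Q₂`. -/
theorem constraint_jet₂ (q2 : Q₂ * A = -((2 : ℝ) • (Q₁ * B)) - Q₀ * C) : Q₂ * (1 - A) + (2 : ℝ) • (Q₁ * (-B)) + Q₀ * (-C) = Q₂ := by
  rw [Matrix.mul_sub, Matrix.mul_one, q2, Matrix.mul_neg, Matrix.mul_neg, smul_neg]; abel

omit [DecidableEq ν] in
/-- [folklore] **THE SIX WARD RULES FROM THE THREE RELATIONS** (right side): with `A = W̃₀τ`, `B = W̃₁τ`, `C = W̃₂τ`,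
`K₀W̃₀ = 0 ⟹ K₀A = 0`, `K₁W̃₀ + K₀W̃₁ = 0 ⟹ K₁A = −K₀B`, `K₂W̃₀ + 2K₁W̃₁ + K₀W̃₂ = 0 ⟹ K₂A = −2K₁B − K₀C`. -/
theorem rules_right {κ : Type*} {K₀ K₁ K₂ : Matrix κ ν ℝ} {V₀ V₁ V₂ : Matrix ν ρ ℝ} (τ : Matrix ρ ν ℝ)
    (a0 : K₀ * V₀ = 0) (a1 : K₁ * V₀ + K₀ * V₁ = 0) (a2 : K₂ * V₀ + (2 : ℝ) • (K₁ * V₁) + K₀ * V₂ = 0) :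
    K₀ * (V₀ * τ) = 0 ∧ K₁ * (V₀ * τ) = -(K₀ * (V₁ * τ)) ∧ K₂ * (V₀ * τ) = -((2 : ℝ) • (K₁ * (V₁ * τ))) - K₀ * (V₂ * τ) := by
  refine ⟨?_, ?_, ?_⟩
  · rw [← Matrix.mul_assoc, a0, Matrix.zero_mul]
  · rw [← Matrix.mul_assoc, eq_neg_iff_add_eq_zero, ← Matrix.mul_assoc, ← Matrix.add_mul, a1, Matrix.zero_mul]
  · have h : K₂ * V₀ = -((2 : ℝ) • (K₁ * V₁)) - K₀ * V₂ := by
      rw [← sub_eq_zero, ← a2]; abel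
    rw [← Matrix.mul_assoc, h, Matrix.sub_mul, Matrix.neg_mul, Matrix.smul_mul, Matrix.mul_assoc, Matrix.mul_assoc]

omit [DecidableEq ν] in
/-- [folklore] **THE SIX WARD RULES, LEFT (TRANSPOSED) SIDE**: from the transposed relations `K₀ᵀW̃₀ = 0`, `K₁ᵀW̃₀ + K₀ᵀW̃₁ = 0`,
`K₂ᵀW̃₀ + 2K₁ᵀW̃₁ + K₀ᵀW̃₂ = 0`: `AᵀK₀ = 0`, `AᵀK₁ = −BᵀK₀`, `AᵀK₂ = −2BᵀK₁ − CᵀK₀`. -/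
theorem rules_left {K₀ K₁ K₂ : Matrix ν ν ℝ} {V₀ V₁ V₂ : Matrix ν ρ ℝ} (τ : Matrix ρ ν ℝ)
    (a0 : K₀ᵀ * V₀ = 0) (a1 : K₁ᵀ * V₀ + K₀ᵀ * V₁ = 0) (a2 : K₂ᵀ * V₀ + (2 : ℝ) • (K₁ᵀ * V₁) + K₀ᵀ * V₂ = 0) :
    (V₀ * τ)ᵀ * K₀ = 0 ∧ (V₀ * τ)ᵀ * K₁ = -((V₁ * τ)ᵀ * K₀) ∧ (V₀ * τ)ᵀ * K₂ = -((2 : ℝ) • ((V₁ * τ)ᵀ * K₁)) - (V₂ * τ)ᵀ * K₀ := by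
  obtain ⟨h0, h1, h2⟩ := rules_right (K₀ := K₀ᵀ) (K₁ := K₁ᵀ) (K₂ := K₂ᵀ) τ a0 a1 a2
  refine ⟨?_, ?_, ?_⟩
  · have := congrArg Matrix.transpose h0
    simpa only [Matrix.transpose_mul, Matrix.transpose_transpose, Matrix.transpose_zero] using this
  · have := congrArg Matrix.transpose h1
    simpa only [Matrix.transpose_mul, Matrix.transpose_transpose, Matrix.transpose_neg] using this
  · have := congrArg Matrix.transpose h2
    simpa only [Matrix.transpose_mul, Matrix.transpose_transpose, Matrix.transpose_neg, Matrix.transpose_sub, Matrix.transpose_smul]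
      using this

end Dressed

end Summit.QuantumFields.BalabanUV.Beta.D1BFx.SliceTransferJetsAlgebra

end
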